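import Literature.NumberTheory.EllipticCurves.FineSelmerRankEqualityRoadInertia
import Literature.NumberTheory.EllipticCurves.FineSelmerRankEqualitySplitCartanFive
import HarnessLib

/-!
# Statement (A) of Coates–Sujatha at `(E, 5)` for the index-`2` subgroup `G₁₆ ≅ M₁₆` of `C_s⁺(5)` FROM THE LAYER-0 RANK EQUALITY ALONE
# (`rank_5 Cl(ℚ(P)) = rank_5 Cl(ℚ(x(P)))`, degrees `8` and `4`; the inertia input is automatic)

Topic `NumberTheory/EllipticCurves` (grouping sub-namespace `CoatesSujatha2005.RankEqualityRoad`).  THEOREM-ONLY (no definition, no named fact, no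
`sorry`); prover seat `bsd-potss-k8t-c4` g26 (cell `bsd-potss`, `--supports stmt-BirchSwinnertonDyer-19982`; closes nothing; neither BSD nor
Conjecture A is booked for any curve).

`E/ℚ` with `Γ_ℚ` acting on `E[5]` in a basis `e` through the index-`2` subgroup `G₁₆ = ⟨diag(1,4), (0 1; 2 0)⟩` of `C_s⁺(5)` (the tree's
`splitCartanIndexTwoBasis_five` shape of k8t-c4 g24 / conjA-anchor: diagonal entries `d = ±a`, antidiagonal entries `c ∈ {2b, 3b}`), `σ_s ↦ diag(1,4)`,
`σ_a ↦ (0 1; 2 0)` (`σ_a⁴ = −1`).  `G₁₆` is the ONLY index-`2` subgroup of `C_s⁺(5)` with surjective determinant acting transitively on the axis points.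
Rank-equality road: `H = ⟨σ̄_s⟩ = Stab(P)`, `P = e⁻¹(1,0)` (`L^H = ℚ(P)`, degree `8`), `H′ = ⟨σ̄_a⁴⟩H` (`L^{H′} = ℚ(x(P))`, degree `4`):

* (private) finite fact: every `M ∈ G₁₆` with `det M = 2` satisfies `M⁴ = −1` (`decide`), so the inertia input `σ̄_a⁴ ∈ I(𝔮|5)` is AUTOMATIC
  (`mem_inertia_of_forall_det_eq_exists_pow_eq`, k8t-c4 g26: `det ρ̄(I(𝔮|5)) = 𝔽₅ˣ`);
* `conjA_five_of_splitCartanIndexTwoBasis_of_rankEq` — `#Cl(ℚ(P))[5] = #Cl(ℚ(x(P)))[5]` (two CERTIFIABLE class numbers) ⟹ statement (A) at `(E,5)` for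
  every cyclotomic `ℤ_5`-extension.  NO `μ`-hypothesis (the `μ`-road door `fineSelmerDual_moduleFinite_of_splitCartanIndexTwoBasis_five_abelian`
  displays five), NO inertia hypothesis, no named fact.

## References

* J. Coates, R. Sujatha, *Fine Selmer groups of elliptic curves over p-adic Lie extensions*, Math. Ann. 331 (2005), §3 Thm. 3.4, Lemma 3.8. [CoatesSujatha2005]
* K. Iwasawa, *A note on class numbers of algebraic number fields*, Abh. Math. Sem. Hamburg 20 (1956), §§3–5. [Iwasawa1956]
* J.-P. Serre, *Propriétés galoisiennes des points d'ordre fini des courbes elliptiques*, Invent. Math. 15 (1972), §2.2, §5.2 (iii). [Serre1972]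
-/

set_option autoImplicit false

noncomputable section

open scoped Classical NumberField Matrix
open WeierstrassCurve Field IntermediateField
  Literature.NumberTheory.GaloisRepresentations Literature.NumberTheory.SerreUniformity
  Literature.NumberTheory.IwasawaTheory Literature.NumberTheory.NumberFields

namespace Literature.NumberTheory.EllipticCurves.CoatesSujatha2005

namespace RankEqualityRoad

/-! ### §0 Finite facts about `G₁₆ ≤ C_s⁺(5)` -/

/-- An element of `splitCartanNormalizer 5` is `(a 0; 0 d)` with `ad ≠ 0` or `(0 b; c 0)` with `bc ≠ 0`. [folklore] -/
private theorem shape_of_mem_splitCartanNormalizer₇ {M : Matrix (Fin 2) (Fin 2) (ZMod 5)}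
    (hM : M ∈ splitCartanNormalizer 5) :
    (∃ a d : ZMod 5, a * d ≠ 0 ∧ M = !![a, 0; 0, d]) ∨ (∃ b c : ZMod 5, b * c ≠ 0 ∧ M = !![0, b; c, 0]) := by
  obtain ⟨hdet, h | h⟩ := hM
  · refine Or.inl ⟨M 0 0, M 1 1, ?_, ?_⟩
    · simpa only [Matrix.det_fin_two, h.1, h.2, mul_zero, sub_zero] using hdet
    · exact Matrix.ext fun i j => by fin_cases i <;> fin_cases j <;> simp [h.1, h.2]
  · refine Or.inr ⟨M 0 1, M 1 0, ?_, ?_⟩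
    · have h' : -(M 0 1 * M 1 0) ≠ 0 := by
        simpa only [Matrix.det_fin_two, h.1, h.2, zero_mul, zero_sub] using hdet
      exact neg_ne_zero.mp h'
    · exact Matrix.ext fun i j => by fin_cases i <;> fin_cases j <;> simp [h.1, h.2]

/-- Diagonal elements of `G₁₆` (`d = ±a`) never have determinant `2`. [folklore] -/
private theorem d_det_ne_two₇ : ∀ a d : ZMod 5, (d = a ∨ d = 4 * a) → (!![a, 0; 0, d] : Matrix (Fin 2) (Fin 2) (ZMod 5)).det ≠ 2 := by
  decide

/-- Antidiagonal elements of `G₁₆` (`c ∈ {2b, 3b}`) of determinant `2` have fourth power `−1`. [folklore] -/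
private theorem a_pow_four₇ : ∀ b c : ZMod 5, (c = 2 * b ∨ c = 3 * b) → (!![0, b; c, 0] : Matrix (Fin 2) (Fin 2) (ZMod 5)).det = 2 →
    (!![0, b; c, 0] : Matrix (Fin 2) (Fin 2) (ZMod 5)) ^ 4 = -1 := by
  decide

/-- **Finite fact.** Every element of `G₁₆ = {M ∈ C_s⁺(5) : M₁₁ = ±M₀₀, M₁₀ ∈ {2M₀₁, 3M₀₁}}` of determinant `2` has a power equal to `−1`. [folklore] -/
private theorem exists_pow_eq_neg_one_of_G16₇ {M : Matrix (Fin 2) (Fin 2) (ZMod 5)} (hM : M ∈ splitCartanNormalizer 5)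
    (hshape : (M 1 1 = M 0 0 ∨ M 1 1 = 4 * M 0 0) ∧ (M 1 0 = 2 * M 0 1 ∨ M 1 0 = 3 * M 0 1)) (hdet : M.det = 2) :
    ∃ k : ℕ, M ^ k = -1 := by
  rcases shape_of_mem_splitCartanNormalizer₇ hM with ⟨a, d, -, rfl⟩ | ⟨b, c, -, rfl⟩
  · have h1 : d = a ∨ d = 4 * a := by simpa using hshape.1
    exact absurd hdet (d_det_ne_two₇ a d h1)
  · have h2 : c = 2 * b ∨ c = 3 * b := by simpa using hshape.2
    exact ⟨4, a_pow_four₇ b c h2 hdet⟩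

/-- `(0 1; 2 0)⁴ = −1`. [folklore] -/
private theorem a_pow_four_eq₇ : (!![0, 1; 2, 0] : Matrix (Fin 2) (Fin 2) (ZMod 5)) ^ 4 = -1 := by decide

/-! ### §1 Statement (A) at `(E, 5)` for a `G₁₆` image from the rank equality alone -/

/-- **(A) at `(E, 5)` for the index-`2` image `G₁₆ ≅ M₁₆` FROM THE RANK EQUALITY ALONE — no `μ`-hypothesis, no inertia hypothesis, no named fact.**
`E/ℚ` elliptic with `Γ_ℚ` acting on `E[5]` in the basis `e` through `G₁₆` (`he`, the tree's index-two shape), `σ_s ↦ diag(1,4)`, `σ_a ↦ (0 1; 2 0)`.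
If `#Cl(ℚ(E[5])^⟨σ̄_s⟩)[5] = #Cl(ℚ(E[5])^⟨σ̄_a⁴, σ̄_s⟩)[5]` (`hrank`: `ℚ(P)` of degree `8` vs `ℚ(x(P))` of degree `4`), then the dual fine Selmer group of
`E` over `ℚ_cyc` is finitely generated over `ℤ_5` for every cyclotomic `ℤ_5`-extension: `conjA_of_rankEq_of_forall_det_eq_exists_pow_eq` (k8t-c4 g26)
with `T = G₁₆`, `u = 2`, `S = diag(1,4)`, `σ_m = σ_a⁴`, `X = (0 1; 2 0)`; (c1) by `not_five_dvd_card_gal_of_splitCartanNormalizer`.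
[cite: CoatesSujatha2005, §3 Thm. 3.4 and Lemma 3.8] [cite: Iwasawa1956, §§3–5] [cite: Serre1972, §2.2 and §5.2 (iii)] -/
theorem conjA_five_of_splitCartanIndexTwoBasis_of_rankEq (W : WeierstrassCurve ℚ) [W.IsElliptic]
    (e : W.geomTorsion (5 : ℕ) ≃+ (Fin 2 → ZMod 5))
    (he : ∀ σ : absoluteGaloisGroup ℚ, ∃ M ∈ splitCartanNormalizer 5, (M 1 1 = M 0 0 ∨ M 1 1 = 4 * M 0 0) ∧
      (M 1 0 = 2 * M 0 1 ∨ M 1 0 = 3 * M 0 1) ∧ ∀ P : W.geomTorsion (5 : ℕ), e (σ • P) = M *ᵥ e P)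
    (σs σa : absoluteGaloisGroup ℚ) (hσs : ∀ P : W.geomTorsion (5 : ℕ), e (σs • P) = !![1, 0; 0, 4] *ᵥ e P)
    (hσa : ∀ P : W.geomTorsion (5 : ℕ), e (σa • P) = !![0, 1; 2, 0] *ᵥ e P)
    (hrank : Nat.card {d : ClassGroup (𝓞 ↥(fixedField (Subgroup.zpowers (absRestrictNormalHom (W.divisionField 5) σs)))) // d ^ 5 = 1} =
      Nat.card {d : ClassGroup (𝓞 ↥(fixedField (Subgroup.zpowers (absRestrictNormalHom (W.divisionField 5) (σa ^ 4)) ⊔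
        Subgroup.zpowers (absRestrictNormalHom (W.divisionField 5) σs)))) // d ^ 5 = 1})
    (κ : ZpExtension ℚ 5) (hκ : κ.IsCyclotomic) :
    ∃ (γ : absoluteGaloisGroup ℚ) (D : W.FineSelmerDualData κ γ),
      Module.Finite ℤ_[5] (RestrictScalars ℤ_[5] (IwasawaAlgebra 5) D.X) := by
  haveI : Fact (Nat.Prime 5) := ⟨by norm_num⟩
  -- the image as a set of matrices `T = G₁₆`
  have heT : ∀ σ : absoluteGaloisGroup ℚ, ∃ M ∈ {M : Matrix (Fin 2) (Fin 2) (ZMod 5) | M ∈ splitCartanNormalizer 5 ∧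
      (M 1 1 = M 0 0 ∨ M 1 1 = 4 * M 0 0) ∧ (M 1 0 = 2 * M 0 1 ∨ M 1 0 = 3 * M 0 1)},
      ∀ P : W.geomTorsion (5 : ℕ), e (σ • P) = M *ᵥ e P := fun σ => by
    obtain ⟨M, hM, h1, h2, hMe⟩ := he σ
    exact ⟨M, ⟨hM, h1, h2⟩, hMe⟩
  have heC : ∀ σ : absoluteGaloisGroup ℚ, ∃ M ∈ splitCartanNormalizer 5, ∀ P : W.geomTorsion (5 : ℕ), e (σ • P) = M *ᵥ e P :=
    fun σ => by obtain ⟨M, hM, -, -, hMe⟩ := he σ; exact ⟨M, hM, hMe⟩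
  have hpow : ∀ (n : ℕ) (P : W.geomTorsion (5 : ℕ)), e ((σa ^ n) • P) = (!![0, 1; 2, 0] : Matrix (Fin 2) (Fin 2) (ZMod 5)) ^ n *ᵥ e P := by
    intro n
    induction n with
    | zero => intro P; rw [pow_zero, one_smul, pow_zero, Matrix.one_mulVec]
    | succ n ih => intro P; rw [pow_succ, mul_smul, ih, hσa, Matrix.mulVec_mulVec, ← pow_succ]
  have hσm : ∀ P : W.geomTorsion (5 : ℕ), e ((σa ^ 4) • P) = -e P := fun P => by
    rw [hpow 4 P, a_pow_four_eq₇, Matrix.neg_mulVec, Matrix.one_mulVec]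
  exact conjA_of_rankEq_of_forall_det_eq_exists_pow_eq W (by norm_num) (not_five_dvd_card_gal_of_splitCartanNormalizer W e heC) e heT
    (ZMod.unitOfCoprime 2 (by norm_num)) (fun M hM hdet => exists_pow_eq_neg_one_of_G16₇ hM.1 hM.2
      (by rw [hdet, ZMod.coe_unitOfCoprime, Nat.cast_ofNat]))
    σs (σa ^ 4) σa (S := !![1, 0; 0, 4]) (by simp) (by simp) hσs hσm (X := !![0, 1; 2, 0]) (by simp) hσa hrank κ hκ

end RankEqualityRoad

end Literature.NumberTheory.EllipticCurves.CoatesSujatha2005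

end
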